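import Literature.Analysis.FluidPDE.NSFourierSobolev
import Literature.Analysis.FluidPDE.TaoClassGlue
import HarnessLib

/-!
# The Fourier–Picard solution is in Tao's smooth `H¹` class

For the classical solution `(u, p)` on the closed slab `[0, T] × ℝ³` synthesized from a
`FourierDatum` (`NSFourierRestart`: the tree's Fourier-side Picard construction of Leray's local
regular solution, restartable from the Fourier-side state at any later time) this file completes
the regularity bookkeeping begun in `NSFourierSobolev` (`FourierDatum.hasBoundedSobolevNormsOn_u`:
`u ∈ L^∞_t H^k_x` for all `k`):

* `FourierDatum.hasBoundedSobolevNormsOn_timeDerivWithin` — `∂ₜu ∈ L^∞_t H^k_x` for all `k`: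
  the one-sided time derivative within `[0, T]` is the synthesis of
  `∂ₜv = -c‖ξ‖² v − N(v, v)` (`FourierDatum.timeDerivWithin_u`), a continuous coefficient field
  with every polynomial decay uniformly in time (`hasDecay_nonlin`), so the Plancherel bound
  `lintegral_levelSq_synthVel_le` of `NSFourierSobolev` applies;
* `FourierDatum.sobolev_p` — `p ∈ L^∞_t H^k_x` for all `k`: `p = Re 𝓕 q` with the pressure
  symbol `q` measurable with every polynomial decay (`FourierDatum.decay_q`, `.aesm_q`); since `q`
  is not continuous at `ξ = 0` the word-derivative dictionary is redone for measurable symbols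
  (`ipderiv_re_fourier_eq`, `lintegral_dnormSq_re_fourier_le`, closed with the tree's scalar
  comparison `sq_norm_iteratedFDeriv_le_card_pow_mul_dnormSq` of `CoordDerivatives`);
* `FourierDatum.continuousInLpOn_u` — `u ∈ C([0, T]; L²)` (dominated convergence on the
  Fourier side and Plancherel; these three lemmas are the `FourierDatum` twins, verbatim up to the
  datum structure, of `ClayDatum.tendsto_lintegral_v_sub` / `…_u_sub` / `continuousInLpOn_u` of
  `NSLocalRegular` — the two datum structures are parallel and not related by a coercion in the
  tree, exactly as `NSFourierRestart` repeats `NSFourierSolution`);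
* `FourierDatum.isTaoSolutionOn` — **the Fourier–Picard solution is a Tao-class solution**
  (`IsTaoSolutionOn T ν (u 0) u p`, `TaoClassGlue.lean`) on its slab `[0, T]`, `T` Picard's time.

This is the input that lets restart arguments in Tao's class (e.g. `NSKatoToClayProofs`,
`TaoLocalisationContinuation`) use the *proved* Fourier-class local existence theorem in place of
the named fact `tao2011_smooth_local_existence` whenever the restart data are Fourier-class.
No definition is introduced.

## References

* J. Leray, Acta Math. 63 (1934), §19 (the regular solution and its derivatives). [Leray1934]
* W. S. Ożański, B. C. Pooley, LMS LN 452, CUP 2018, Cor. 6.16 (all derivatives of the local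
  strong solution lie in `L²`, uniformly on compact time intervals). [OzanskiPooley2018]
* T. Tao, Anal. PDE 6 (2013), Thm. 5.4 (the class). [Tao2011]
-/

noncomputable section

open MeasureTheory Real Set Filter Topology Function Complex FourierTransform VectorFourier
  InnerProductSpace
open scoped FourierTransform RealInnerProductSpace ENNReal NNReal ContDiff ComplexConjugate

namespace Literature.Analysis.FluidPDE.FourierNS

variable {ι : Type*} [Fintype ι] [DecidableEq ι]

/-! ### Word derivatives of scalar syntheses with measurable symbols -/

section Scalar

variable {g : EuclideanSpace ℝ ι → ℂ}

omit [DecidableEq ι] in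
/-- Measurability of the symbol-weighted function `dsym α · g`. [folklore] -/
theorem aesm_dsym_mul {m : ℕ} (hgm : AEStronglyMeasurable g volume) (α : Fin m → ι) :
    AEStronglyMeasurable (fun ξ => dsym α ξ * g ξ) volume :=
  (continuous_dsym α).aestronglyMeasurable.mul hgm

omit [DecidableEq ι] in
/-- **`Re 𝓕 g` is smooth** for a measurable symbol with every polynomial decay. [folklore] -/
theorem contDiff_re_fourier_of_hasDecay (hgm : AEStronglyMeasurable g volume)
    (hdec : ∀ K : ℕ, ∃ B, HasDecay K B g) : ContDiff ℝ ∞ fun y => (𝓕 g y).re := by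
  refine contDiff_infty.2 fun n => ?_
  obtain ⟨B, hB⟩ := hdec (n + (Fintype.card ι + 1))
  exact Complex.reCLM.contDiff.comp (contDiff_fourier' (n := n) (Nat.lt_succ_self _) hB hgm)

/-- **Word derivatives of a scalar synthesis** (measurable symbol):
`∂^α Re 𝓕 g = Re 𝓕 (dsym α · g)`. [folklore] -/
theorem ipderiv_re_fourier_eq (hgm : AEStronglyMeasurable g volume)
    (hdec : ∀ K : ℕ, ∃ B, HasDecay K B g) :
    ∀ {m : ℕ} (α : Fin m → ι),
      ipderiv α (fun y => (𝓕 g y).re) = fun x => (𝓕 (fun ξ => dsym α ξ * g ξ) x).re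
  | 0, α => by
      funext x
      simp
  | m + 1, α => by
      rw [ipderiv_succ, ipderiv_re_fourier_eq hgm hdec (Fin.tail α)]
      obtain ⟨B, hB⟩ := hdec (1 + (Fintype.card ι + 1) + m)
      have hg : HasDecay (1 + (Fintype.card ι + 1)) ((2 * π) ^ m * B)
          (fun ξ => dsym (Fin.tail α) ξ * g ξ) := hB.dsym_mul (Fin.tail α)
      rw [pderiv_re_fourier (Nat.lt_succ_self _) hg (aesm_dsym_mul hgm _) (α 0)]
      funext x
      congr 2
      refine congrFun (fourier_congr' fun ξ => ?_) x
      rw [dsym_succ]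
      ring

/-- **Plancherel bound for one word derivative of a scalar synthesis**:
`∫ (∂^α Re 𝓕 g)² ≤ ((2π)^m B)² I_{card ι + 1}` for `g` of order `card ι + 1 + m`. [folklore] -/
theorem lintegral_ipderiv_re_fourier_sq_le (hgm : AEStronglyMeasurable g volume)
    (hdec : ∀ K : ℕ, ∃ B, HasDecay K B g) {m : ℕ} (α : Fin m → ι) {B : ℝ}
    (hB : HasDecay (Fintype.card ι + 1 + m) B g) :
    ∫⁻ x, ENNReal.ofReal (ipderiv α (fun y => (𝓕 g y).re) x ^ 2) ≤
      ENNReal.ofReal (((2 * π) ^ m * B) ^ 2 * weightMass (EuclideanSpace ℝ ι) (Fintype.card ι + 1)) := by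
  rw [ipderiv_re_fourier_eq hgm hdec α]
  have hg := hB.dsym_mul α
  calc ∫⁻ x, ENNReal.ofReal ((𝓕 (fun ξ => dsym α ξ * g ξ) x).re ^ 2)
      ≤ ∫⁻ x, ‖𝓕 (fun ξ => dsym α ξ * g ξ) x‖ₑ ^ 2 := lintegral_mono fun x => ofReal_re_sq_le _
    _ ≤ _ := lintegral_sq_fourier_le (Nat.lt_succ_self _) hg (aesm_dsym_mul hgm α)

/-- **All coordinate tensors of a scalar synthesis are square integrable**, with an explicit
bound: `∫ |∇ᵐ Re 𝓕 g|² ≤ card ι^m ((2π)^m B)² I_{card ι + 1}`. [folklore] -/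
theorem lintegral_dnormSq_re_fourier_le (hgm : AEStronglyMeasurable g volume)
    (hdec : ∀ K : ℕ, ∃ B, HasDecay K B g) (m : ℕ) {B : ℝ}
    (hB : HasDecay (Fintype.card ι + 1 + m) B g) :
    ∫⁻ x, ENNReal.ofReal (dnormSq m (fun y => (𝓕 g y).re) x) ≤
      Fintype.card (Fin m → ι) * ENNReal.ofReal (((2 * π) ^ m * B) ^ 2 *
        weightMass (EuclideanSpace ℝ ι) (Fintype.card ι + 1)) := by
  have hsm := contDiff_re_fourier_of_hasDecay hgm hdec
  have hmeas : ∀ α : Fin m → ι,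
      Measurable fun x => ENNReal.ofReal (ipderiv α (fun y => (𝓕 g y).re) x ^ 2) := fun α =>
    ((contDiff_ipderiv hsm α).continuous.pow 2).measurable.ennreal_ofReal
  calc ∫⁻ x, ENNReal.ofReal (dnormSq m (fun y => (𝓕 g y).re) x)
      = ∫⁻ x, ∑ α : Fin m → ι, ENNReal.ofReal (ipderiv α (fun y => (𝓕 g y).re) x ^ 2) := by
        refine lintegral_congr fun x => ?_
        unfold dnormSq
        exact ENNReal.ofReal_sum_of_nonneg fun α _ => sq_nonneg _
    _ = ∑ α : Fin m → ι, ∫⁻ x, ENNReal.ofReal (ipderiv α (fun y => (𝓕 g y).re) x ^ 2) :=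
        lintegral_finsetSum _ fun α _ => hmeas α
    _ ≤ ∑ _α : Fin m → ι, ENNReal.ofReal (((2 * π) ^ m * B) ^ 2 *
          weightMass (EuclideanSpace ℝ ι) (Fintype.card ι + 1)) :=
        Finset.sum_le_sum fun α _ => lintegral_ipderiv_re_fourier_sq_le hgm hdec α hB
    _ = _ := by rw [Finset.sum_const, Finset.card_univ, nsmul_eq_mul]

/-- **Sobolev bound of a scalar synthesis**: for a measurable symbol with every polynomial decay,
`∫ ‖Dᵐ Re 𝓕 g‖² ≤ (card ι)^m · card(Fin m → ι) · ((2π)^m B)² I_{card ι+1}`, `B` the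
order-`(card ι + 1 + m)` decay constant (the tree's comparison
`sq_norm_iteratedFDeriv_le_card_pow_mul_dnormSq` and `lintegral_dnormSq_re_fourier_le`). [folklore] -/
theorem lintegral_sq_norm_iteratedFDeriv_re_fourier_le (hgm : AEStronglyMeasurable g volume)
    (hdec : ∀ K : ℕ, ∃ B, HasDecay K B g) (m : ℕ) {B : ℝ}
    (hB : HasDecay (Fintype.card ι + 1 + m) B g) :
    ∫⁻ x, ‖iteratedFDeriv ℝ m (fun y => (𝓕 g y).re) x‖ₑ ^ 2 ≤
      ENNReal.ofReal ((Fintype.card ι : ℝ) ^ m) * (Fintype.card (Fin m → ι) *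
        ENNReal.ofReal (((2 * π) ^ m * B) ^ 2 *
          weightMass (EuclideanSpace ℝ ι) (Fintype.card ι + 1))) := by
  have hsm := contDiff_re_fourier_of_hasDecay hgm hdec
  calc ∫⁻ x, ‖iteratedFDeriv ℝ m (fun y => (𝓕 g y).re) x‖ₑ ^ 2
      ≤ ∫⁻ x, ENNReal.ofReal ((Fintype.card ι : ℝ) ^ m * dnormSq m (fun y => (𝓕 g y).re) x) := by
        refine lintegral_mono fun x => ?_
        rw [← ofReal_norm, ← ENNReal.ofReal_pow (norm_nonneg _)]
        exact ENNReal.ofReal_le_ofReal (sq_norm_iteratedFDeriv_le_card_pow_mul_dnormSq hsm m x)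
    _ = ENNReal.ofReal ((Fintype.card ι : ℝ) ^ m) *
          ∫⁻ x, ENNReal.ofReal (dnormSq m (fun y => (𝓕 g y).re) x) := by
        rw [← lintegral_const_mul' _ _ ENNReal.ofReal_ne_top]
        refine lintegral_congr fun x => ?_
        rw [ENNReal.ofReal_mul (by positivity)]
    _ ≤ _ := mul_le_mul_right (lintegral_dnormSq_re_fourier_le hgm hdec m hB) _

end Scalar

/-! ### The Fourier–Picard solution: `∂ₜu`, `p`, `L²`-continuity, Tao's class -/

namespace FourierDatum

open ClayDatum (reVec reVec_apply)

section General

variable (d : FourierDatum ι)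

/-- The symbol of the time derivative, `Dt(t)(ξ)_l = -c‖ξ‖² v_l(t,ξ) − N(v(t), v(t))(ξ)_l`. We do
not introduce a definition: the expression is spelled out in each statement. Its synthesis is the
one-sided time derivative of `u` within `[0, T]` (`FourierDatum.timeDerivWithin_u`). [folklore] -/
theorem timeDerivWithin_u_eq_synthVel {t : ℝ} (ht : t ∈ Icc 0 d.T) :
    timeDerivWithin (Icc 0 d.T) d.u t = synthVel fun ξ l =>
      -((d.c * ‖ξ‖ ^ 2 : ℝ) : ℂ) * d.v t ξ l - nonlin (d.v t) (d.v t) ξ l := by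
  funext x
  rw [d.timeDerivWithin_u x ht]
  rfl

/-- The time-derivative symbol is continuous in `ξ` (the nonlinearity by
`continuous_nonlin_param`). [folklore] -/
theorem continuous_dtSymbol (t : ℝ) : Continuous fun ξ : EuclideanSpace ℝ ι => fun l : ι =>
      -((d.c * ‖ξ‖ ^ 2 : ℝ) : ℂ) * d.v t ξ l - nonlin (d.v t) (d.v t) ξ l := by
  have hN : Continuous fun ξ : EuclideanSpace ℝ ι => nonlin (d.v t) (d.v t) ξ :=
    continuous_nonlin_param (X := EuclideanSpace ℝ ι) d.hK₀ (V := fun _ => d.v t)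
      (W := fun _ => d.v t) (ζ := id) (fun _ => (d.continuous_v_slice t).aestronglyMeasurable)
      (fun _ => (d.continuous_v_slice t).aestronglyMeasurable) (fun _ => d.decay_v t)
      (fun _ => d.decay_v t) (fun _ => continuous_const)
      (fun η => (d.continuous_v_slice t).comp (continuous_id.sub continuous_const)) continuous_id
  refine continuous_pi fun l => ?_
  refine Continuous.sub ?_ ((continuous_apply l).comp hN)
  exact ((Complex.continuous_ofReal.comp (by fun_prop)).neg).mul
    ((continuous_apply l).comp (d.continuous_v_slice t))

/-- **Every polynomial decay of the time-derivative symbol, uniformly in time**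
(`‖ξ‖² v` from the decay of `v` two orders up; `N(v, v)` by `hasDecay_nonlin`). [folklore] -/
theorem decay_dtSymbol (K : ℕ) : ∃ B, ∀ t, HasDecay K B (fun ξ : EuclideanSpace ℝ ι => fun l : ι =>
      -((d.c * ‖ξ‖ ^ 2 : ℝ) : ℂ) * d.v t ξ l - nonlin (d.v t) (d.v t) ξ l) := by
  obtain ⟨B₂, hB₂⟩ := d.decay_v_all (2 + K)
  obtain ⟨B₁, hB₁⟩ := d.decay_v_all (K + 1)
  have hc := d.c_pos
  have hR : 0 ≤ d.R := d.hyp.R_nonneg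
  set BN : ℝ := nonlinConst ι (K + 1) d.K₀ * (B₁ * d.R + d.R * B₁) with hBN
  refine ⟨d.c * B₂ + BN, fun t => ?_⟩
  have hlin : HasDecay K (d.c * B₂) (fun ξ : EuclideanSpace ℝ ι => fun l : ι =>
      -((d.c * ‖ξ‖ ^ 2 : ℝ) : ℂ) * d.v t ξ l) := by
    have hB0 : 0 ≤ B₂ := (hB₂ t).nonneg
    refine HasDecay.of_apply (by positivity) fun l ξ => ?_
    have h := ((hB₂ t).apply l).pow_mul_norm_le (n := 2) (K := K) ξ
    rw [norm_mul, norm_neg, Complex.norm_real, Real.norm_of_nonneg (by positivity)]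
    calc d.c * ‖ξ‖ ^ 2 * ‖d.v t ξ l‖ = d.c * (‖ξ‖ ^ 2 * ‖d.v t ξ l‖) := by ring
      _ ≤ d.c * (B₂ * ((1 + ‖ξ‖) ^ K)⁻¹) := mul_le_mul_of_nonneg_left h hc.le
      _ = d.c * B₂ * ((1 + ‖ξ‖) ^ K)⁻¹ := by ring
  have hN : HasDecay K BN (nonlin (d.v t) (d.v t)) :=
    hasDecay_nonlin d.hK₀ (d.decay_v t) (hB₁ t) (d.decay_v t) (hB₁ t)
      (d.continuous_v_slice t).aestronglyMeasurable (d.continuous_v_slice t).aestronglyMeasurable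
  have h := hlin.sub hN
  convert h using 2 with ξ
  funext l
  simp only [Pi.sub_apply]

end General

section R3

variable (d : FourierDatum (Fin 3))

/-- **`∂ₜu ∈ L^∞_t H^k_x([0, T] × ℝ³)` for every `k`** (Tao 2013, Thm. 5.4 (iv), `j = 1`): the
Sobolev norms of the one-sided time derivative of the Fourier–Picard velocity are bounded on
`[0, T]`, by the Plancherel bound for syntheses (`lintegral_levelSq_synthVel_le`) applied to the
time-derivative symbol. [cite: Tao2011, Thm. 5.4 (iv)] -/
theorem hasBoundedSobolevNormsOn_timeDerivWithin :
    HasBoundedSobolevNormsOn (Icc 0 d.T) (timeDerivWithin (Icc 0 d.T) d.u) := by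
  intro n
  obtain ⟨B, hB⟩ := d.decay_dtSymbol (Fintype.card (Fin 3) + 1 + n)
  set C : ℝ≥0∞ := Fintype.card (Fin 3) * (Fintype.card (Fin n → Fin 3) *
    ENNReal.ofReal (((2 * π) ^ n * B) ^ 2 *
      weightMass (EuclideanSpace ℝ (Fin 3)) (Fintype.card (Fin 3) + 1))) with hCdef
  have hC : C < ⊤ := ENNReal.mul_lt_top (ENNReal.natCast_lt_top _)
    (ENNReal.mul_lt_top (ENNReal.natCast_lt_top _) ENNReal.ofReal_lt_top)
  refine ⟨(ENNReal.ofReal (3 ^ (n + 1)) * C).toNNReal, fun t ht => ?_⟩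
  rw [ENNReal.coe_toNNReal (ENNReal.mul_lt_top ENNReal.ofReal_lt_top hC).ne, d.timeDerivWithin_u_eq_synthVel ht]
  set V₀ : EuclideanSpace ℝ (Fin 3) → Fin 3 → ℂ := fun ξ l =>
    -((d.c * ‖ξ‖ ^ 2 : ℝ) : ℂ) * d.v t ξ l - nonlin (d.v t) (d.v t) ξ l with hV₀
  have hcV : Continuous V₀ := d.continuous_dtSymbol t
  have hdecV : ∀ K : ℕ, ∃ B', HasDecay K B' V₀ := fun K => by
    obtain ⟨B', hB'⟩ := d.decay_dtSymbol K
    exact ⟨B', hB' t⟩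
  have hv := contDiff_synthVel V₀ hcV hdecV
  calc ∫⁻ x, ‖iteratedFDeriv ℝ n (synthVel V₀) x‖ₑ ^ 2
      ≤ ∫⁻ x, ENNReal.ofReal (3 ^ (n + 1) * levelSq n (synthVel V₀) x) := by
        refine lintegral_mono fun x => ?_
        rw [← ofReal_norm, ← ENNReal.ofReal_pow (norm_nonneg _)]
        exact ENNReal.ofReal_le_ofReal (sq_norm_iteratedFDeriv_le_pow_mul_levelSq hv n x)
    _ = ENNReal.ofReal (3 ^ (n + 1)) * ∫⁻ x, ENNReal.ofReal (levelSq n (synthVel V₀) x) := by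
        rw [← lintegral_const_mul' _ _ ENNReal.ofReal_ne_top]
        refine lintegral_congr fun x => ?_
        rw [ENNReal.ofReal_mul (by positivity)]
    _ ≤ ENNReal.ofReal (3 ^ (n + 1)) * C :=
        mul_le_mul_right (lintegral_levelSq_synthVel_le V₀ hcV hdecV n (hB t)) _

/-- **`p ∈ L^∞_t H^k_x([0, T] × ℝ³)` for every `k`** (Tao 2013, Thm. 5.4 (iv), `j = 0` for the
pressure): `p = Re 𝓕 q` with the pressure symbol `q(t)` measurable with every polynomial decay
uniformly in `t` (`FourierDatum.decay_q`). [cite: Tao2011, Thm. 5.4 (iv)] -/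
theorem sobolev_p : ∀ n : ℕ, ∃ C : ℝ≥0, ∀ t ∈ Icc 0 d.T,
    ∫⁻ x, ‖iteratedFDeriv ℝ n (d.p t) x‖ₑ ^ 2 ≤ C := by
  intro n
  obtain ⟨B, hB⟩ := d.decay_q (Fintype.card (Fin 3) + 1 + n)
  set C : ℝ≥0∞ := ENNReal.ofReal ((Fintype.card (Fin 3) : ℝ) ^ n) * (Fintype.card (Fin n → Fin 3) *
    ENNReal.ofReal (((2 * π) ^ n * B) ^ 2 *
      weightMass (EuclideanSpace ℝ (Fin 3)) (Fintype.card (Fin 3) + 1))) with hCdef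
  have hC : C < ⊤ := ENNReal.mul_lt_top ENNReal.ofReal_lt_top
    (ENNReal.mul_lt_top (ENNReal.natCast_lt_top _) ENNReal.ofReal_lt_top)
  refine ⟨C.toNNReal, fun t _ => ?_⟩
  rw [ENNReal.coe_toNNReal hC.ne]
  have hdec : ∀ K : ℕ, ∃ B', HasDecay K B' (d.q t) := fun K => by
    obtain ⟨B', hB'⟩ := d.decay_q K
    exact ⟨B', hB' t⟩
  have hp : d.p t = fun y => (𝓕 (d.q t) y).re := rfl
  rw [hp]
  exact lintegral_sq_norm_iteratedFDeriv_re_fourier_le (d.aesm_q t) hdec n (hB t)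

end R3

section Continuity

variable (d : FourierDatum ι)

/-- Dominated convergence on the Fourier side: `∫ ‖v_l(t) − v_l(t₀)‖² → 0` as `t → t₀`
(the `FourierDatum` twin of `ClayDatum.tendsto_lintegral_v_sub` of `NSLocalRegular`, verbatim up
to the datum structure — as `NSFourierRestart` repeats `NSFourierSolution`; the two structures are
not related by a coercion in the tree). [folklore] -/
theorem tendsto_lintegral_v_sub (t₀ : ℝ) (l : ι) :
    Tendsto (fun t => ∫⁻ ξ, ‖d.v t ξ l - d.v t₀ ξ l‖ₑ ^ 2) (𝓝 t₀) (𝓝 0) := by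
  have hI := integrable_inv_one_add_norm_pow (E := EuclideanSpace ℝ ι) (finrank_lt_of_card_lt d.hK₀)
  have hR := d.hyp.R_nonneg
  set bound : EuclideanSpace ℝ ι → ℝ≥0∞ := fun ξ => ENNReal.ofReal ((2 * d.R) ^ 2 * ((1 + ‖ξ‖) ^ d.K₀)⁻¹)
  have h := tendsto_lintegral_filter_of_dominated_convergence (μ := volume) (l := 𝓝 t₀)
    (F := fun t ξ => ‖d.v t ξ l - d.v t₀ ξ l‖ₑ ^ 2) (f := fun _ => 0) bound ?_ ?_ ?_ ?_
  · simpa using h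
  · refine Eventually.of_forall fun t => ?_
    have hm : Measurable fun ξ => d.v t ξ l - d.v t₀ ξ l :=
      (measurable_pi_apply l).comp ((d.continuous_v_slice t).sub (d.continuous_v_slice t₀)).measurable
    exact hm.enorm.pow_const 2
  · refine Eventually.of_forall fun t => Eventually.of_forall fun ξ => ?_
    have hdec : HasDecay d.K₀ (d.R + d.R) (fun ξ => d.v t ξ l - d.v t₀ ξ l) :=
      ((d.decay_v t).apply l).sub ((d.decay_v t₀).apply l)
    simp only [bound]
    rw [← ofReal_norm, ← ENNReal.ofReal_pow (norm_nonneg _)]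
    refine ENNReal.ofReal_le_ofReal ?_
    have h1 := hdec ξ
    have hw := inv_one_add_norm_pow_le_one ξ d.K₀
    have hw0 : 0 ≤ ((1 + ‖ξ‖) ^ d.K₀)⁻¹ := by positivity
    calc ‖d.v t ξ l - d.v t₀ ξ l‖ ^ 2 ≤ ((d.R + d.R) * ((1 + ‖ξ‖) ^ d.K₀)⁻¹) ^ 2 :=
          pow_le_pow_left₀ (norm_nonneg _) h1 2
      _ = (2 * d.R) ^ 2 * ((1 + ‖ξ‖) ^ d.K₀)⁻¹ * ((1 + ‖ξ‖) ^ d.K₀)⁻¹ := by ring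
      _ ≤ (2 * d.R) ^ 2 * ((1 + ‖ξ‖) ^ d.K₀)⁻¹ * 1 := by gcongr
      _ = (2 * d.R) ^ 2 * ((1 + ‖ξ‖) ^ d.K₀)⁻¹ := mul_one _
  · simp only [bound]
    rw [← ofReal_integral_eq_lintegral_ofReal (hI.const_mul _)
      (Eventually.of_forall fun ξ => by positivity)]
    exact ENNReal.ofReal_ne_top
  · refine Eventually.of_forall fun ξ => ?_
    have hc : Continuous fun t => d.v t ξ l :=
      (continuous_apply l).comp (d.continuous_v.comp (continuous_id.prodMk continuous_const))
    have h2 : Tendsto (fun t => ‖d.v t ξ l - d.v t₀ ξ l‖ₑ ^ 2) (𝓝 t₀)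
        (𝓝 (‖d.v t₀ ξ l - d.v t₀ ξ l‖ₑ ^ 2)) :=
      ((ENNReal.continuous_pow 2).comp (hc.sub continuous_const).enorm).tendsto t₀
    simpa using h2

/-- `∫ ‖u(t) − u(t₀)‖² → 0` as `t → t₀` (Plancherel componentwise; `FourierDatum` twin of
`ClayDatum.tendsto_lintegral_u_sub`). [folklore] -/
theorem tendsto_lintegral_u_sub (t₀ : ℝ) :
    Tendsto (fun t => ∫⁻ x, ‖d.u t x - d.u t₀ x‖ₑ ^ 2) (𝓝 t₀) (𝓝 0) := by
  have hvj : ∀ t j, Integrable fun ξ => d.v t ξ j := fun t j =>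
    ((d.decay_v t).apply j).integrable (finrank_lt_of_card_lt d.hK₀) (d.aesm_v t j)
  -- pointwise: `‖u t x - u t₀ x‖² ≤ ∑ₗ ‖𝓕 (v_l t - v_l t₀) x‖²`
  have hpt : ∀ t x, ‖d.u t x - d.u t₀ x‖ₑ ^ 2 ≤
      ∑ l, ‖𝓕 (fun ξ => d.v t ξ l - d.v t₀ ξ l) x‖ₑ ^ 2 := by
    intro t x
    have hsub : d.u t x - d.u t₀ x = reVec (fun l => 𝓕 (fun ξ => d.v t ξ l - d.v t₀ ξ l) x) := by
      have : d.u t x - d.u t₀ x = reVec (d.U t x - d.U t₀ x) := by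
        simp only [u, map_sub]
      rw [this]
      congr 1
      funext l
      rw [Pi.sub_apply, U, U, ← fourier_sub' (hvj t l) (hvj t₀ l)]
      rfl
    rw [hsub]
    exact enorm_reVec_sq_le _
  have hsum : Tendsto (fun t => ∑ l, ∫⁻ x, ‖𝓕 (fun ξ => d.v t ξ l - d.v t₀ ξ l) x‖ₑ ^ 2) (𝓝 t₀)
      (𝓝 0) := by
    rw [show (0 : ℝ≥0∞) = ∑ _l : ι, 0 by simp]
    refine tendsto_finsetSum _ fun l _ => ?_
    have heq : ∀ t, ∫⁻ x, ‖𝓕 (fun ξ => d.v t ξ l - d.v t₀ ξ l) x‖ₑ ^ 2 =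
        ∫⁻ ξ, ‖d.v t ξ l - d.v t₀ ξ l‖ₑ ^ 2 := fun t =>
      lintegral_sq_fourier_eq ((hvj t l).sub (hvj t₀ l))
        (memLp_two_of_hasDecay d.hK₀ (((d.decay_v t).apply l).sub ((d.decay_v t₀).apply l))
          ((d.aesm_v t l).sub (d.aesm_v t₀ l)))
    simp_rw [heq]
    exact d.tendsto_lintegral_v_sub t₀ l
  refine tendsto_of_tendsto_of_tendsto_of_le_of_le tendsto_const_nhds hsum (fun _ => bot_le) fun t => ?_
  calc ∫⁻ x, ‖d.u t x - d.u t₀ x‖ₑ ^ 2 ≤ ∫⁻ x, ∑ l, ‖𝓕 (fun ξ => d.v t ξ l - d.v t₀ ξ l) x‖ₑ ^ 2 :=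
        lintegral_mono (hpt t)
    _ = ∑ l, ∫⁻ x, ‖𝓕 (fun ξ => d.v t ξ l - d.v t₀ ξ l) x‖ₑ ^ 2 := by
        refine lintegral_finsetSum' _ fun l _ => ?_
        exact (continuous_fourierIntegral ((hvj t l).sub (hvj t₀ l))).measurable.enorm.pow_const 2
          |>.aemeasurable

/-- **`u ∈ C([0, T]; L²)`** (indeed on all of `ℝ`; Tao 2013, Thm. 5.4 (i): `u ∈ C⁰_t H¹_x`, here
the `L²` part; `FourierDatum` twin of `ClayDatum.continuousInLpOn_u`). [cite: Tao2011, Thm. 5.4 (i)] -/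
theorem continuousInLpOn_u : ContinuousInLpOn (Icc 0 d.T) 2 d.u := by
  refine ⟨fun t _ => d.memLp_u t, fun t₀ _ => ?_⟩
  have h : Tendsto (fun t => eLpNorm (d.u t - d.u t₀) 2 volume) (𝓝 t₀) (𝓝 0) := by
    have h1 : ∀ t, eLpNorm (d.u t - d.u t₀) 2 volume = (∫⁻ x, ‖d.u t x - d.u t₀ x‖ₑ ^ 2) ^ (1 / 2 : ℝ) :=
      fun t => eLpNorm_two_eq_sqrt _
    simp_rw [h1]
    have h2 := (ENNReal.continuous_rpow_const (y := (1 / 2 : ℝ))).tendsto 0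
    rw [ENNReal.zero_rpow_of_pos (by norm_num)] at h2
    exact h2.comp (d.tendsto_lintegral_u_sub t₀)
  exact h.mono_left nhdsWithin_le_nhds

end Continuity

/-- **The Fourier–Picard solution is a Tao-class solution.** For a `FourierDatum` on `ℝ³`
(viscosity `ν`, Fourier-side datum `a`), the synthesized classical solution `(u, p)` on the closed
slab `[0, T] × ℝ³`, `T` Picard's time, is in Tao's smooth `H¹` class from the datum `u 0 = Re 𝓕 a`
(`IsTaoSolutionOn T ν (u 0) u p`, `TaoClassGlue.lean`): classical (`isClassicalNSSolutionOn`),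
`u ∈ L^∞_t H^k_x` (`hasBoundedSobolevNormsOn_u`), `∂ₜu ∈ L^∞_t H^k_x`
(`hasBoundedSobolevNormsOn_timeDerivWithin`), `p ∈ L^∞_t H^k_x` (`sobolev_p`),
`u ∈ C([0,T]; L²)` (`continuousInLpOn_u`). This is Leray's regular solution seen in the class of
Tao 2013, Thm. 5.4 (ii)+(iv). [cite: Tao2011, Thm. 5.4 (ii)+(iv)] -/
theorem isTaoSolutionOn (d : FourierDatum (Fin 3)) : IsTaoSolutionOn d.T d.ν (d.u 0) d.u d.p where
  classical := d.isClassicalNSSolutionOn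
  initial := rfl
  sobolev := d.hasBoundedSobolevNormsOn_u (Icc 0 d.T)
  sobolev_dt := d.hasBoundedSobolevNormsOn_timeDerivWithin
  sobolev_p := d.sobolev_p
  continuousL2 := d.continuousInLpOn_u

end FourierDatum

end Literature.Analysis.FluidPDE.FourierNS

end
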